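import Literature.Algebra.Homology.DiscreteRepExtInternalHom
import Literature.Algebra.Homology.ExtOfAcyclicResolutionPrecomp
import Literature.Algebra.Homology.DiscreteRepStandardResolutionNaturality
import HarnessLib

/-!
# Naturality IN `N` of `Extⁿ_{C_Γ}(N, X) ≃+ Extⁿ_{C_Γ}(triv k, Hom(N, X)) ≃+ Hⁿ_cont(Γ, Hom(N, X))`
# (Harari Prop. 16.16 / Lemma 17.21 (a): functoriality of `Extʳ_G(N, P) = Hʳ(G, Hom(N, P))` in the module)

Topic `Algebra/Homology`; namespace `Literature.Algebra.Homology.DiscreteRep`.  Definitions with bodies (the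
morphism `Hom(G, P) : Hom(N, P) ⟶ Hom(N', P)` of `C_Γ` and its natural transformation) and theorems; no named
fact, no instance, no notation, no `sorry`.  Sequel of door-c4's `DiscreteRepInternalHom` /
`DiscreteRepExtInternalHom` (the comparison `extIhomAddEquiv N X hX hN n` and its continuous-cohomology form
`extIhomAddEquivContinuousCohomology`), of `ExtOfAcyclicResolutionPrecomp` (bsd-eis -w7 g12: naturality of the
engine `Extⁿ(X, M) ≅ Hⁿ(Ext⁰(X, I•))` in the first variable), `ExtOfAcyclicResolutionNaturality` (door-c4:
naturality in the resolution) and `DiscreteRepStandardResolutionNaturality` (door-c4: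
`extTrivAddEquivContinuousCohomology_naturality`).

THE MATHEMATICS.  For a morphism `G : N' ⟶ N` of finitely generated discrete `Γ`-modules and `X` discrete,
pre-composition `G^* : Extⁿ(N, X) → Extⁿ(N', X)` corresponds, under the comparison of Harari Prop. 16.16 (b)
/ Milne I 0.8 / Harari Lemma 17.21 (a), to the map induced on `Hⁿ_cont(Γ, ·)` by
`Hom(G, X) : Hom(N, X) → Hom(N', X)`, `F ↦ F ∘ G` — "these isomorphisms are functorial" (Harari §16.2, (16.4);
Milne I §0).  The three constituents of door-c4's comparison are natural separately: the engine on the standard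
complex of `X` in its first variable (`extAddEquivHomologySucc_precomp`), the curry isomorphism of
`Ext⁰`-complexes (`extComplexCurryIso_hom_precomp`: `curry([G] ∘ x) = curry(x) ∘ Hom(G, ·)`), and the engine on
the `Hom` complex `Hom(N, std• X)` along the cochain map `Hom(G, std• X)` (door-c4's naturality in the
resolution).

MAIN RESULTS: `ihomPrecomp G P`, `ihomPrecompNatTrans G`; **`extIhomAddEquiv_precomp`**:
`extIhomAddEquiv N' X hX hN' n ([G] ∘ x) = (extIhomAddEquiv N X hX hN n x) ∘ [Hom(G, X)]`;
**`extIhomAddEquivContinuousCohomology_precomp`**: for discrete `Y ≅ Hom(N, X)`, `Y' ≅ Hom(N', X)` and a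
morphism `φ : Y ⟶ Y'` matching `Hom(G, X)` under the identifications,
`Hⁿ(φ) (cmp_N x) = cmp_{N'} ([G] ∘ x)` — the hypothesis `hcmpG` of `ShaExtRoad.pairing_natural` on Milne's
`Ext` road to the `S`-restricted `Ш`-pairing (Milne ADT I Thm. 4.10 (a)), background lane «PT-Ш-S-TC» of crux
`stmt-BirchSwinnertonDyer-19032` (cell bsd-eis, seat bsd-line-x1-p1-w7 gen 12, brick D4a file C2).
HONEST FRAMING: homological algebra only; no duality theorem and no case of BSD is proved here.  AI
formalisation, established only by the kernel check.

## References
* D. Harari, *Galois Cohomology and Class Field Theory*, Universitext (2020), §16.2: Prop. 16.16 (p. 271),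
  formula (16.4); Lemma 17.21 (a) (p. 297). [Harari2020]
* J. S. Milne, *Arithmetic Duality Theorems*, 2nd ed. (2006), I §0 (Example 0.8, functoriality of the pairings),
  I Thm. 4.10 (a). [MilneADT2006]
* C. A. Weibel, *An introduction to homological algebra* (1994), §2.7. [Weibel1994]
-/

noncomputable section

universe u

namespace Literature.Algebra.Homology

namespace DiscreteRep

open CategoryTheory CategoryTheory.Limits CategoryTheory.Abelian TopRep
open scoped _root_.Topology

variable {k Γ : Type u} [CommRing k] [TopologicalSpace k] [Group Γ] [TopologicalSpace Γ]
  [IsTopologicalGroup Γ]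

/-! ## §1 `Hom(G, P) : Hom(N, P) ⟶ Hom(N', P)` -/

section Precomp

variable {N N' : DiscreteRepCat k Γ} [Module.Finite k N.obj.V] [Module.Finite k N'.obj.V] (G : N' ⟶ N)
  (P : DiscreteRepCat k Γ)

omit [TopologicalSpace k] in
/-- **`Hom(G, P) : Hom(N, P) ⟶ Hom(N', P)`, `F ↦ F ∘ G`**, a morphism of `C_Γ` (pre-composition with an equivariant
map commutes with the conjugation action). [cite: Harari2020, §16.2, Definition 16.10 and (16.4)] -/
def ihomPrecomp : ihomObj N P ⟶ ihomObj N' P :=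
  ObjectProperty.homMk (Rep.ofHom
    ⟨LinearMap.lcomp k P.obj.V G.hom.hom.toLinearMap, fun g =>
      LinearMap.ext fun F => LinearMap.ext fun x => by
        change ((P.obj.ρ g ∘ₗ F ∘ₗ N.obj.ρ g⁻¹) ∘ₗ G.hom.hom.toLinearMap) x =
          (P.obj.ρ g ∘ₗ (F ∘ₗ G.hom.hom.toLinearMap) ∘ₗ N'.obj.ρ g⁻¹) x
        simp only [LinearMap.coe_comp, Function.comp_apply, Representation.IntertwiningMap.coe_toLinearMap]
        rw [Rep.hom_comm_apply]⟩)

omit [TopologicalSpace k] in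
/-- Formula: `Hom(G, P) F = F ∘ G`. [cite: Harari2020, §16.2, (16.4)] -/
@[simp]
theorem ihomPrecomp_hom_apply (F : N.obj.V →ₗ[k] P.obj.V) :
    (ihomPrecomp G P).hom.hom F = F ∘ₗ G.hom.hom.toLinearMap := rfl

omit [TopologicalSpace k] in
/-- **`Hom(G, ·)` as a natural transformation `Hom(N, ·) ⟶ Hom(N', ·)`** (`(h ∘ F) ∘ G = h ∘ (F ∘ G)`).
[cite: Harari2020, §16.2, Definition 16.11 and (16.4)] -/
def ihomPrecompNatTrans : ihomFunctor N ⟶ ihomFunctor N' where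
  app P := ihomPrecomp G P
  naturality _ _ _ :=
    ObjectProperty.hom_ext _ (Rep.hom_ext (DFunLike.ext _ _ fun _ => LinearMap.ext fun _ => rfl))

omit [TopologicalSpace k] in
/-- Components of `ihomPrecompNatTrans`. [cite: Harari2020, §16.2, (16.4)] -/
@[simp]
theorem ihomPrecompNatTrans_app : (ihomPrecompNatTrans G).app P = ihomPrecomp G P := rfl

/-! ## §2 Curry is natural in `N` -/

variable {P} in
omit [TopologicalSpace k] in
/-- `curry (G ≫ f) = curry f ≫ Hom(G, P)`. [cite: Harari2020, §16.2, Theorem 16.14 (proof, (16.2)) and (16.4)] -/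
theorem curryHom_precomp (f : N ⟶ P) : curryHom N' (G ≫ f) = curryHom N f ≫ ihomPrecomp G P := by
  refine ObjectProperty.hom_ext _ (Rep.hom_ext (DFunLike.ext _ _ fun c => LinearMap.ext fun x => ?_))
  change (c • (G ≫ f).hom.hom.toLinearMap) x =
    ((ihomPrecomp G P).hom.hom (c • f.hom.hom.toLinearMap) : N'.obj.V →ₗ[k] P.obj.V) x
  rw [ihomPrecomp_hom_apply, LinearMap.smul_apply, LinearMap.comp_apply, LinearMap.smul_apply]
  rfl

omit [TopologicalSpace k] [Module.Finite k N.obj.V] [Module.Finite k N'.obj.V] in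
/-- `Ext⁰`-functoriality in the first variable read through `addEquiv₀`: `addEquiv₀ ([G] ∘ x) = G ≫ addEquiv₀ x`.
[cite: Weibel1994, §2.7] -/
theorem addEquiv₀_mk₀_comp {L : DiscreteRepCat k Γ} (x : Ext N L 0) :
    Ext.addEquiv₀ ((Ext.mk₀ G).comp x (zero_add 0)) = G ≫ Ext.addEquiv₀ x := by
  apply Ext.addEquiv₀.symm.injective
  rw [AddEquiv.symm_apply_apply, Ext.addEquiv₀_symm_apply, ← Ext.mk₀_comp_mk₀, Ext.mk₀_addEquiv₀_apply]

omit [TopologicalSpace k] in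
/-- **`curryExt₀` is natural in `N`**: `curry ([G] ∘ x) = curry x ∘ [Hom(G, P)]` on `Ext⁰`.
[cite: Harari2020, §16.2, Theorem 16.14 (proof, (16.2)) and (16.4)] -/
theorem curryExt₀_mk₀_comp (x : Ext N P 0) :
    curryExt₀ N' P ((Ext.mk₀ G).comp x (zero_add 0)) =
      (curryExt₀ N P x).comp (Ext.mk₀ (ihomPrecomp G P)) (add_zero 0) := by
  apply Ext.addEquiv₀.injective
  rw [addEquiv₀_comp_mk₀]
  simp only [curryExt₀, AddEquiv.trans_apply, AddEquiv.apply_symm_apply, curryHomAddEquiv_apply]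
  rw [addEquiv₀_mk₀_comp, curryHom_precomp]

omit [TopologicalSpace k] in
/-- **The curry isomorphism of `Ext⁰`-complexes is natural in `N`**: `G^*` on `Ext⁰(N, I•)` corresponds to
`Hom(G, I•)_*` on `Ext⁰(triv k, Hom(N, I•))`. [cite: Harari2020, §16.2, Theorem 16.14 (proof, (16.2)) and (16.4)] -/
theorem extComplexCurryIso_hom_precomp (I : CochainComplex (DiscreteRepCat k Γ) ℕ) :
    AcyclicResolution.extComplexPrecomp G I ≫ (extComplexCurryIso N' I).hom =
      (extComplexCurryIso N I).hom ≫ AcyclicResolution.extComplexMap (triv (Γ := Γ) k)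
        ((NatTrans.mapHomologicalComplex (ihomPrecompNatTrans G) (ComplexShape.up ℕ)).app I) := by
  refine HomologicalComplex.hom_ext _ _ fun n => ?_
  ext x
  change curryExt₀ N' (I.X n) ((Ext.mk₀ G).comp x (zero_add 0)) =
    (curryExt₀ N (I.X n) x).comp (Ext.mk₀ (ihomPrecomp G (I.X n))) (add_zero 0)
  exact curryExt₀_mk₀_comp G (I.X n) x

omit [TopologicalSpace k] in
/-- Hence on homology: `Hⁿ(G^*) ≫ curry = curry ≫ Hⁿ(Hom(G, I•)_*)`.
[cite: Harari2020, §16.2, Theorem 16.14 (proof, (16.2)) and (16.4)] -/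
theorem extComplexCurryHomologyIso_hom_precomp (I : CochainComplex (DiscreteRepCat k Γ) ℕ) (n : ℕ) :
    HomologicalComplex.homologyMap (AcyclicResolution.extComplexPrecomp G I) n ≫
        (extComplexCurryHomologyIso N' I n).hom =
      (extComplexCurryHomologyIso N I n).hom ≫
        HomologicalComplex.homologyMap (AcyclicResolution.extComplexMap (triv (Γ := Γ) k)
          ((NatTrans.mapHomologicalComplex (ihomPrecompNatTrans G) (ComplexShape.up ℕ)).app I)) n := by
  change HomologicalComplex.homologyMap _ n ≫ HomologicalComplex.homologyMap _ n =
    HomologicalComplex.homologyMap _ n ≫ HomologicalComplex.homologyMap _ n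
  rw [← HomologicalComplex.homologyMap_comp, ← HomologicalComplex.homologyMap_comp,
    extComplexCurryIso_hom_precomp]

end Precomp

/-! ## §3 The comparison `extIhomAddEquiv` is natural in `N` -/

section Main

variable [CompactSpace Γ] {N N' : DiscreteRepCat k Γ} [Module.Finite k N.obj.V] [Module.Finite k N'.obj.V]
  (G : N' ⟶ N) (X : TopRep.{u} k Γ) [DiscreteTopology X.V] (hX : IsDiscrete ((forgetTop k Γ).obj X))

/-- The cochain map `Hom(G, std• X) : Hom(N, std• X) ⟶ Hom(N', std• X)`.
[cite: Harari2020, §16.2, Theorem 16.14 (proof) and (16.4)] -/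
abbrev ihomStdComplexPrecomp : ihomStdComplex N X hX ⟶ ihomStdComplex N' X hX :=
  (NatTrans.mapHomologicalComplex (ihomPrecompNatTrans G) (ComplexShape.up ℕ)).app (stdComplex X hX)

/-- The augmentations of the two `Hom` complexes are compatible with `Hom(G, ·)`.
[cite: Harari2020, §16.2, Theorem 16.14 (proof) and (16.4)] -/
theorem ihomStdη_precomp :
    ihomStdη N X hX ≫ (ihomStdComplexPrecomp G X hX).f 0 =
      ihomPrecomp G (stdBase X hX) ≫ ihomStdη N' X hX :=
  (ihomPrecompNatTrans G).naturality (stdη X hX)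

/-- **`extTrivIhomAddEquivHomology` is natural in `N`** (door-c4's naturality in the resolution, along
`Hom(G, std• X)`). [cite: Harari2020, §16.2, Theorem 16.14 (proof) and (16.4)] -/
theorem extTrivIhomAddEquivHomology_precomp (n : ℕ) (y : Ext (triv (Γ := Γ) k) (ihomObj N (stdBase X hX)) n) :
    (HomologicalComplex.homologyMap (AcyclicResolution.extComplexMap (triv (Γ := Γ) k)
        (ihomStdComplexPrecomp G X hX)) n).hom (extTrivIhomAddEquivHomology N X hX n y) =
      extTrivIhomAddEquivHomology N' X hX n (y.comp (Ext.mk₀ (ihomPrecomp G (stdBase X hX))) (add_zero n)) := by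
  haveI := mono_ihomStdη N X hX
  haveI := mono_ihomStdη N' X hX
  cases n with
  | zero =>
    exact AcyclicResolution.extAddEquivHomologyZero_naturality (triv (Γ := Γ) k)
      (ihomStdComplexPrecomp G X hX) (ihomStdη N X hX) (ihomStdη_d N X hX) (exact_ihomStdη N X hX)
      (ihomStdη N' X hX) (ihomStdη_d N' X hX) (exact_ihomStdη N' X hX) (ihomPrecomp G (stdBase X hX))
      (ihomStdη_precomp G X hX) y
  | succ n =>
    exact AcyclicResolution.extAddEquivHomologySucc_naturality (triv (Γ := Γ) k)
      (ihomStdComplexPrecomp G X hX) (ihomStdη N X hX) (ihomStdη_d N X hX) (exact_ihomStdη N X hX)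
      (ihomStdη N' X hX) (ihomStdη_d N' X hX) (exact_ihomStdη N' X hX) (ihomPrecomp G (stdBase X hX))
      (ihomStdη_precomp G X hX) (ihomStdComplex_exactAt_succ N X hX)
      (ext_triv_ihomStdComplex_X_eq_zero N X hX) (ihomStdComplex_exactAt_succ N' X hX)
      (ext_triv_ihomStdComplex_X_eq_zero N' X hX) n y

variable (hN : ∀ n q (e : Ext N ((stdComplex X hX).X n) (q + 1)), e = 0)
  (hN' : ∀ n q (e : Ext N' ((stdComplex X hX).X n) (q + 1)), e = 0)

omit [Module.Finite k N.obj.V] [Module.Finite k N'.obj.V] in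
/-- **`extAddEquivStdHomology` is natural in `N`** (the engine in its first variable).
[cite: Harari2020, §16.2, Theorem 16.14 (proof) and (16.4)] -/
theorem extAddEquivStdHomology_precomp (n : ℕ) (x : Ext N (stdBase X hX) n) :
    (HomologicalComplex.homologyMap (AcyclicResolution.extComplexPrecomp G (stdComplex X hX)) n).hom
        (extAddEquivStdHomology N X hX hN n x) =
      extAddEquivStdHomology N' X hX hN' n ((Ext.mk₀ G).comp x (zero_add n)) := by
  cases n with
  | zero =>
    exact AcyclicResolution.extAddEquivHomologyZero_precomp G (stdComplex X hX) (stdη X hX) (stdη_d X hX)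
      (exact_stdη X hX) x
  | succ n =>
    exact AcyclicResolution.extAddEquivHomologySucc_precomp G (stdComplex X hX) (stdη X hX) (stdη_d X hX)
      (exact_stdη X hX) (stdComplex_exactAt_succ X hX) hN hN' n x

/-- **THE COMPARISON `Extⁿ_{C_Γ}(N, X) ≃+ Extⁿ_{C_Γ}(triv k, Hom(N, X))` IS NATURAL IN `N`**:
`extIhomAddEquiv N' ([G] ∘ x) = (extIhomAddEquiv N x) ∘ [Hom(G, X)]`.
[cite: Harari2020, §16.2, Proposition 16.16 and (16.4)][cite: MilneADT2006, I §0 Example 0.8] -/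
theorem extIhomAddEquiv_precomp (n : ℕ) (x : Ext N (stdBase X hX) n) :
    extIhomAddEquiv N' X hX hN' n ((Ext.mk₀ G).comp x (zero_add n)) =
      (extIhomAddEquiv N X hX hN n x).comp (Ext.mk₀ (ihomPrecomp G (stdBase X hX))) (add_zero n) := by
  -- abbreviations
  set E := extTrivIhomAddEquivHomology N X hX n with hE
  set E' := extTrivIhomAddEquivHomology N' X hX n with hE'
  -- unfold `extIhomAddEquiv`
  change E'.symm ((extComplexCurryHomologyIso N' (stdComplex X hX) n).addCommGroupIsoToAddEquiv
      (extAddEquivStdHomology N' X hX hN' n ((Ext.mk₀ G).comp x (zero_add n)))) =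
    (E.symm ((extComplexCurryHomologyIso N (stdComplex X hX) n).addCommGroupIsoToAddEquiv
      (extAddEquivStdHomology N X hX hN n x))).comp (Ext.mk₀ (ihomPrecomp G (stdBase X hX))) (add_zero n)
  rw [← extAddEquivStdHomology_precomp G X hX hN hN' n x]
  -- the curry square on homology, applied to the element
  have hsq := congrArg (fun f => f.hom (extAddEquivStdHomology N X hX hN n x))
    (extComplexCurryHomologyIso_hom_precomp G (stdComplex X hX) n)
  change (extComplexCurryHomologyIso N' (stdComplex X hX) n).addCommGroupIsoToAddEquiv
      ((HomologicalComplex.homologyMap (AcyclicResolution.extComplexPrecomp G (stdComplex X hX)) n).hom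
        (extAddEquivStdHomology N X hX hN n x)) =
    (HomologicalComplex.homologyMap (AcyclicResolution.extComplexMap (triv (Γ := Γ) k)
        (ihomStdComplexPrecomp G X hX)) n).hom
      ((extComplexCurryHomologyIso N (stdComplex X hX) n).addCommGroupIsoToAddEquiv
        (extAddEquivStdHomology N X hX hN n x)) at hsq
  rw [hsq]
  -- the `Hom`-complex engine square, in inverse form
  apply E'.injective
  rw [AddEquiv.apply_symm_apply, ← extTrivIhomAddEquivHomology_precomp G X hX n, AddEquiv.apply_symm_apply]

/-- **THE COMPARISON `Extⁿ_{C_Γ}(N, X) ≃+ Hⁿ_cont(Γ, Y)` (`Y ≅ Hom(N, X)`) IS NATURAL IN `N`**: for `G : N' ⟶ N`,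
discrete `Y ≅ Hom(N, X)`, `Y' ≅ Hom(N', X)` in `C_Γ` and a morphism `φ : Y ⟶ Y'` that is `Hom(G, X)` under the
identifications (`hφ`), `Hⁿ(φ) (cmp_N x) = cmp_{N'} ([G] ∘ x)`.
[cite: Harari2020, Lemma 17.21 (a) and §16.2 (16.4)][cite: MilneADT2006, I Thm. 4.10 (a) (proof, p. 58)] -/
theorem extIhomAddEquivContinuousCohomology_precomp {Y Y' : TopRep.{u} k Γ} [DiscreteTopology Y.V]
    [DiscreteTopology Y'.V] (hY : IsDiscrete ((forgetTop k Γ).obj Y)) (hY' : IsDiscrete ((forgetTop k Γ).obj Y'))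
    (e : stdBase Y hY ≅ ihomObj N (stdBase X hX)) (e' : stdBase Y' hY' ≅ ihomObj N' (stdBase X hX))
    (φ : Y ⟶ Y') (hφ : stdBaseMap hY hY' φ ≫ e'.hom = e.hom ≫ ihomPrecomp G (stdBase X hX))
    (n : ℕ) (x : Ext N (stdBase X hX) n) :
    (ContinuousCohomology.map (ContinuousMonoidHom.id Γ) (X := Y) (Y := Y') φ n).hom
        (extIhomAddEquivContinuousCohomology N X hX hN Y hY e n x) =
      extIhomAddEquivContinuousCohomology N' X hX hN' Y' hY' e' n ((Ext.mk₀ G).comp x (zero_add n)) := by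
  -- `e⁻¹ ≫ φ = Hom(G, X) ≫ e'⁻¹`
  have hφ' : e.inv ≫ stdBaseMap hY hY' φ = ihomPrecomp G (stdBase X hX) ≫ e'.inv := by
    rw [Iso.inv_comp_eq, ← Category.assoc, ← hφ, Category.assoc, Iso.hom_inv_id, Category.comp_id]
  change (ContinuousCohomology.map (ContinuousMonoidHom.id Γ) (X := Y) (Y := Y') φ n).hom
      (extTrivAddEquivContinuousCohomology Y hY n
        (AcyclicResolution.extAddEquivOfIso (triv k) e.symm n (extIhomAddEquiv N X hX hN n x))) =
    extTrivAddEquivContinuousCohomology Y' hY' n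
      (AcyclicResolution.extAddEquivOfIso (triv k) e'.symm n
        (extIhomAddEquiv N' X hX hN' n ((Ext.mk₀ G).comp x (zero_add n))))
  rw [extTrivAddEquivContinuousCohomology_naturality hY hY' φ n, extIhomAddEquiv_precomp G X hX hN hN' n x,
    AcyclicResolution.extAddEquivOfIso_apply, AcyclicResolution.extAddEquivOfIso_apply, Iso.symm_hom,
    Iso.symm_hom, Ext.comp_assoc_of_second_deg_zero, Ext.comp_assoc_of_second_deg_zero, Ext.mk₀_comp_mk₀,
    Ext.mk₀_comp_mk₀, hφ']

end Main

end DiscreteRep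

end Literature.Algebra.Homology

end
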